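import Summits.AtomisticToContinuum.BoseEinsteinCondensation.Theorems.BECStoquasticCensoringHomogeneousVillainLRO
import HarnessLib

/-!
# `VillainCurrentLRO` (route BECStoquasticCensoring, item stmt-AtomisticToContinuum-11474) — closing proof

Uniform equal-time block long-range order `c (M+1)⁶ Z(0) ≤ ∑_{x,y} Z(δ_{(x,0)} − δ_{(y,0)})` of the
(3+1)-dimensional Villain integer-current model on `(ℤ/(M+1)ℤ)³ × ℤ/(T+1)ℤ` for EVERY bondwise
stiffness field `κ` pinched between direction-wise base stiffnesses `K_i ≥ K₀` and `Λ K_i`,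
with `K₀, c` independent of `Λ ≥ 1`, `M`, `T`, `K_i` — PROVED (`villainCurrentLRO_proof`).

Proof.  The engine `villainCurrent_blockSum_lowerBound` (tree,
`Theorems/BECStoquasticCensoringHomogeneousVillainLRO.lean`) is stated for an ARBITRARY bondwise
stiffness field `≥ K₀`; the item's inline `ℝ≥0∞` current sums are the current sums of
`VillainCurrentModel.ofCurried κ` (`currentSum_ofCurried`) and its inline sources are
`wormSource x y` (`inlineSource_eq_wormSource`).  The lower pinch `K₀ ≤ K_i ≤ κ` feeds the
engine's hypothesis; the upper pinch `κ ≤ Λ K_i` is not used (Ginibre monotonicity,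
[AizenmanEtAl2021, Cor. 11.4], is inside the engine).

The proof runs THROUGH the two REGISTERED STUBS of the crux skeleton `Cruxes/VillainCurrentLRO/Lines/birth.lean`
(`stub_ginibreMonotone`, `stub_isotropicFloorLRO`; signatures verbatim) are discharged as well,
from `VillainCurrentModel.twoPoint_mono` and the engine at a constant field.

## References

* C. Garban, T. Spencer, J. Math. Phys. 63 (2022) 093302, Thm 1.3, Remarks 1, 10. [GarbanSpencer2022]
* M. Aizenman, M. Harel, R. Peled, J. Shapiro, arXiv:2110.09498, Cor. 11.4. [AizenmanEtAl2021]
* J. Fröhlich, T. Spencer, Comm. Math. Phys. 83 (1982) 411–454, §2. [FrohlichSpencerCMP1982]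
-/

noncomputable section

namespace Summit.AtomisticToContinuum.BoseEinsteinCondensation.Theorems

open Finset
open scoped BigOperators ENNReal
open Literature.Probability.LatticeModels Literature.Probability.LatticeModels.JCurrent

namespace VillainCurrentLRO

/-- **Registered stub `stub_ginibreMonotone` (verbatim signature)** — Ginibre monotonicity of the
equal-time worm two-point function in the stiffness field: the equal-time case of the tree's
`VillainCurrentModel.twoPoint_mono` (Aizenman–Harel–Peled–Shapiro 2021, Cor. 11.4, current side).
[cite: AizenmanEtAl2021, Cor. 11.4] -/
theorem stub_ginibreMonotone :
    ∀ (M T : ℕ) (P Q : VillainCurrentModel 3 (M + 1) (T + 1)),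
      (∀ b, P.stiffness b ≤ Q.stiffness b) →
      ∀ x y : TorusSite 3 (M + 1),
        P.twoPoint ((x, 0) : SpaceTimeSite 3 (M + 1) (T + 1)) (y, 0) ≤
          Q.twoPoint ((x, 0) : SpaceTimeSite 3 (M + 1) (T + 1)) (y, 0) :=
  fun _M _T P Q h x y => P.twoPoint_mono Q h (x, 0) (y, 0)

/-- **Registered stub `stub_isotropicFloorLRO` (verbatim signature)** — equal-time block long-range
order of the constant-stiffness floor model, uniformly in `M`, `T`: the constant-field case of the
engine `villainCurrent_blockSum_lowerBound`, divided by `Z(0)` (`sum_twoPoint_equalTime`).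
[cite: GarbanSpencer2022, Thm 1.3] -/
theorem stub_isotropicFloorLRO :
    ∃ K₀ c : ℝ, 0 < K₀ ∧ 0 < c ∧ ∀ (M T : ℕ) (K : ℝ), K₀ ≤ K →
      ∀ P₀ : VillainCurrentModel 3 (M + 1) (T + 1), (∀ b, P₀.stiffness b = K) →
        ENNReal.ofReal c * ((M + 1 : ℝ≥0∞) ^ 6) ≤
          ∑ x : TorusSite 3 (M + 1), ∑ y : TorusSite 3 (M + 1),
            P₀.twoPoint ((x, 0) : SpaceTimeSite 3 (M + 1) (T + 1)) (y, 0) := by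
  obtain ⟨K₀, c, hK₀, hc, H⟩ := villainCurrent_blockSum_lowerBound
  refine ⟨K₀, c, hK₀, hc, ?_⟩
  intro M T K hK P₀ hP₀
  have h := H M T P₀ (fun b => hK.trans (hP₀ b).ge)
  rw [VillainCurrentModel.sum_twoPoint_equalTime,
    ENNReal.le_div_iff_mul_le (Or.inl P₀.partitionFunction_ne_zero)
      (Or.inl P₀.partitionFunction_ne_top)]
  exact h

end VillainCurrentLRO

/-- **`VillainCurrentLRO` (item stmt-AtomisticToContinuum-11474), proved.**  For every `Λ ≥ 1`
there are `K₀, c > 0` (here independent of `Λ`) such that for all `M, T`, all direction-wise base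
stiffnesses `K_i ≥ K₀` and every bond stiffness field `κ` with `K_i ≤ κ ≤ Λ K_i`, the Villain
current model on `(ℤ/(M+1))³ × ℤ/(T+1)` satisfies `c (M+1)⁶ Z(0) ≤ ∑_{x,y} Z(δ_{(x,0)} − δ_{(y,0)})`.
Proof = the registered skeleton `Cruxes/VillainCurrentLRO/Lines/birth.lean` (`VillainCurrentLRO_of`)
run on the two discharged stubs above: dictionary `currentSum_ofCurried` /
`inlineSource_eq_wormSource`, comparison `κ ≥ K_i ≥ K₀` down to the constant floor model by
`stub_ginibreMonotone`, the floor's block LRO by `stub_isotropicFloorLRO`, and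
`Z(ρ_{xy}) = G · Z(0)` (`twoPoint_equalTime`).  The upper pinch `κ ≤ Λ K_i` is not used.
[cite: GarbanSpencer2022, Thm 1.3; AizenmanEtAl2021, Cor. 11.4] -/
theorem villainCurrentLRO_proof :
    Summit.AtomisticToContinuum.BoseEinsteinCondensation.Theses.BECStoquasticCensoring.VillainCurrentLRO := by
  obtain ⟨K₀, c, hK₀, hc, H⟩ := VillainCurrentLRO.stub_isotropicFloorLRO
  intro Λ _hΛ
  refine ⟨K₀, c, hc, ?_⟩
  intro M T Kd hKd κ hκ Z
  -- positivity of the base stiffnesses and of the stiffness field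
  have hKpos : ∀ i, 0 < Kd i := fun i => lt_of_lt_of_le hK₀ (hKd i)
  have hκpos : ∀ s i, 0 < κ s i := fun s i => lt_of_lt_of_le (hKpos i) (hκ s i).1
  -- the item's inline current sums are the current sums of the Villain current model `ofCurried κ`
  have hZ : ∀ q : SpaceTimeSite 3 (M + 1) (T + 1) → ℤ,
      Z q = (VillainCurrentModel.ofCurried (d := 3) (L := M + 1) (M := T + 1) κ hκpos).currentSum q :=
    fun q => (VillainCurrentModel.currentSum_ofCurried (d := 3) (L := M + 1) (M := T + 1) κ hκpos q).symm
  have hsrc : ∀ x y : TorusSite 3 (M + 1),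
      (fun z : SpaceTimeSite 3 (M + 1) (T + 1) =>
        (if z = (x, 0) then (1 : ℤ) else 0) - (if z = (y, 0) then 1 else 0)) = wormSource x y :=
    fun x y => VillainCurrentModel.inlineSource_eq_wormSource x y
  -- the model and the constant floor model `K₀ ≤ K_i ≤ κ`
  set P : VillainCurrentModel 3 (M + 1) (T + 1) :=
    VillainCurrentModel.ofCurried (d := 3) (L := M + 1) (M := T + 1) κ hκpos with hP
  obtain ⟨P₀, hP₀⟩ : ∃ P₀ : VillainCurrentModel 3 (M + 1) (T + 1), ∀ b, P₀.stiffness b = K₀ :=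
    ⟨VillainCurrentModel.homogeneous (fun _ => K₀) (fun _ => hK₀), fun _ => rfl⟩
  have hle : ∀ b, P₀.stiffness b ≤ P.stiffness b := by
    intro b
    rw [hP₀ b, hP, VillainCurrentModel.ofCurried_stiffness]
    exact (hKd _).trans (hκ _ _).1
  -- floor LRO (stub 2) and termwise Ginibre comparison (stub 1)
  have hkey : ENNReal.ofReal c * ((M + 1 : ℝ≥0∞) ^ 6) ≤
      ∑ x : TorusSite 3 (M + 1), ∑ y : TorusSite 3 (M + 1),
        P.twoPoint ((x, 0) : SpaceTimeSite 3 (M + 1) (T + 1)) (y, 0) :=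
    (H M T K₀ le_rfl P₀ hP₀).trans
      (Finset.sum_le_sum fun x _ => Finset.sum_le_sum fun y _ =>
        VillainCurrentLRO.stub_ginibreMonotone M T P₀ P hle x y)
  -- back to the current sums: `Z(ρ_{xy}) = G_P((x,0),(y,0)) · Z(0)`
  calc ENNReal.ofReal c * ((M + 1 : ℝ≥0∞) ^ 6) * Z 0
      = ENNReal.ofReal c * ((M + 1 : ℝ≥0∞) ^ 6) * P.partitionFunction := by
        rw [hZ 0]; rfl
    _ ≤ (∑ x : TorusSite 3 (M + 1), ∑ y : TorusSite 3 (M + 1),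
          P.twoPoint ((x, 0) : SpaceTimeSite 3 (M + 1) (T + 1)) (y, 0)) * P.partitionFunction :=
        mul_le_mul' hkey le_rfl
    _ = ∑ x : TorusSite 3 (M + 1), ∑ y : TorusSite 3 (M + 1),
          P.twoPoint ((x, 0) : SpaceTimeSite 3 (M + 1) (T + 1)) (y, 0) * P.partitionFunction := by
        rw [Finset.sum_mul]
        exact Finset.sum_congr rfl fun x _ => Finset.sum_mul _ _ _
    _ = ∑ x : Fin 3 → ZMod (M + 1), ∑ y : Fin 3 → ZMod (M + 1),
          Z (fun z => (if z = (x, 0) then 1 else 0) - (if z = (y, 0) then 1 else 0)) := by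
        refine Finset.sum_congr rfl fun x _ => Finset.sum_congr rfl fun y _ => ?_
        rw [hsrc x y, hZ, VillainCurrentModel.twoPoint_equalTime,
          ENNReal.div_mul_cancel P.partitionFunction_ne_zero P.partitionFunction_ne_top]

end Summit.AtomisticToContinuum.BoseEinsteinCondensation.Theorems
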